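import Summits.HubbardSuperconductivity.HubbardSuperconductivity.Theorems.AnisotropyChordTransferFibre3FinX5SoundA
import Summits.HubbardSuperconductivity.HubbardSuperconductivity.Theorems.AnisotropyChordTransferFibre3FinX3GM3

/-!
# Route `AnisotropyChord` / H0 rotor rung: FIN per-`L` GM₃ (X5) — the row-C cell on point wedges is sound; ★★★ `gm3_of_gmCheck5`

Soundness layer 4 of `…FinX5Eval`: ★ `xc_cell_soundA` / `xc_cellAny_soundA` — a passing `xcCellOKA` on the recomputed Green point
wedges (kernel facts rewrite them to certified literal tables), together with the `T⁺·D` brackets `tb` exported by the row-`N₁` fact, gives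
the row-C bracket tuple of `KT2Assembly.offPoleTailAbs_of_brackets` with `b = bn/bd` for every ground profile of the cell (tables `fTabA` /
`gTabA` enclose by `…FinX5Tables`, objects by `…FinX5SoundA.xcObjG_sound`, inequality bookkeeping g6's); and the GM₃ glue in the X5 form
(`cellsAllG5_cons_append`, `cover_allG5`, ★ `gm3_of_gmCellOK5`, ★★★ `gm3_of_gmCheck5`: `GM3Fibre L Δ` for every `0 < Δ ≤ Δ₁ < 1`, `9 ≤ L`).
Prover seat `hubbard-h0-rotor-p3` g8; helper for piece A = stmt-HubbardSuperconductivity-23918 of rung 19089 (`--supports`, helper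
class).  WHAT THIS IS NOT: nothing here proves superconductivity in the Hubbard model (rotor TARGET as worded stays FALSE, g15 verdict);
the per-`L` GM₃ input of ONE conditional reduction from kernel cell facts.  Tree imports only; no sorry, no new axioms.
-/

set_option linter.dupNamespace false
set_option autoImplicit false

namespace Summit.HubbardSuperconductivity.HubbardSuperconductivity.Theorems.AnisotropyChord.Transfer.Fibre3

namespace FinXB

open scoped BigOperators
open Finset Hole2 FinCell

variable {L : ℕ} [NeZero L]

/-- ★ THE ROW-C X5 CELL CERTIFICATE IS SOUND: with `tb.1 ≤ T⁺·D ≤ tb.2`, a passing `xcCellOKA` on the recomputed point wedges gives the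
row-C bracket tuple of `KT2Assembly.offPoleTailAbs_of_brackets` (`b = bn/bd`) for every ground profile of the cell. [folklore] -/
theorem xc_cell_soundA (hL : 5 ≤ L) {Δ lam2 : ℝ} (hΔ0 : 0 < Δ) (hΔ1 : Δ < 1) {f : Tor L → ℝ}
    (hf : IsGroundTwoMagnon L Δ lam2 f) {la lb : ℤ}
    (hla : (la : ℝ) ≤ lam2 * ((D : ℤ) : ℝ)) (hlb : lam2 * ((D : ℤ) : ℝ) ≤ (lb : ℝ))
    {tb : ℤ × ℤ} (hTlo : (tb.1 : ℝ) ≤ Tplus L Δ f * ((D : ℤ) : ℝ)) (hThi : Tplus L Δ f * ((D : ℤ) : ℝ) ≤ (tb.2 : ℝ))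
    {bn bd : ℕ} (hcert : xcCellOKA L la lb bn bd tb (gWedgePt L la) (gWedgePt L lb) = true) :
    ∃ Chi Nhi Plo Llo Tlo Thi : ℝ,
      cs2 L f ≤ Chi ∧ nC0p L Δ f ≤ Nhi ∧ Plo ≤ polePart L Δ f ∧ Llo ≤ lowNormPart L Δ f ∧
      Tlo ≤ Tplus L Δ f ∧ Tplus L Δ f ≤ Thi ∧ Thi ≤ 2 * eps1 L ∧ 0 ≤ Tlo ∧
      (3 * Real.sqrt Chi + 3 * Real.sqrt Nhi) ^ 2 - Plo - Llo
        ≤ ((bn : ℝ) / bd) * ((L : ℝ) ^ 2 * lam2 / 4) * (2 * eps1 L - Thi) * (3 * ((L : ℝ) ^ 2) ^ 2 * Tlo) := by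
  unfold xcCellOKA at hcert
  simp only [Bool.and_eq_true, decide_eq_true_eq] at hcert
  obtain ⟨⟨⟨hposa, hposb⟩, hla0⟩, hcert⟩ := hcert
  unfold xcCellOKT at hcert
  simp only [Bool.and_eq_true, decide_eq_true_eq] at hcert
  obtain ⟨⟨⟨⟨⟨⟨⟨hchk, hsc⟩, hbd⟩, hMok⟩, htlo0⟩, hthi⟩, heta0⟩, hineq⟩ := hcert
  have H : CellHyp (L := L) Δ lam2 f la lb := ⟨hL, hΔ0.le, hΔ1, hf, hla, hlb, hchk, hsc⟩
  have hD := D_pos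
  have hL3 : 3 ≤ L := by omega
  have hlam : 0 < lam2 := lam2_pos L hL3 hΔ1 hf.1
  have hfe : f = groundF L lam2 := ground_eq_explicit L (by omega) hΔ0.le hΔ1 hf
  set ft := fTabA L la lb (gWedgePt L la) (gWedgePt L lb) with hftdef
  set gx := gTabA L la lb (gWedgePt L la) (gWedgePt L lb) ft with hgxdef
  have hft : TabEncl L f ft := by rw [hfe, hftdef]; exact tabEnclA (L := L) hL3 hlam hla hlb hchk hposa hposb
  have hgx : GradEncl L f gx := by
    intro r1 r2 h1 h2
    have h := gradEnclA (L := L) hL3 hlam hla hlb hchk hposa hposb h1 h2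
    rw [hfe]
    unfold np ex
    rw [hgxdef, hftdef]
    simpa using h
  set S := xbScal L la lb (gresCellTab L (cosTab L) la lb) with hSdef
  set C := xcObjT L S tb ft gx with hCdef
  obtain ⟨Chi, Nhi, hChi, hNhi, hChi0, hNhi0, mChi, mNhi, mEta⟩ := xcObjG_sound H hft hgx tb hMok
  have etlo : C.tlo = tb.1 := rfl
  have ethi : C.thi = tb.2 := rfl
  have meps : mem (eps1 L) S.eps1 := H.hS.2.2.2.2.2.2.2.2.2.2
  refine ⟨Chi, Nhi, 0, 0, (C.tlo : ℝ) / ((D : ℤ) : ℝ), (C.thi : ℝ) / ((D : ℤ) : ℝ), hChi, hNhi,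
    polePartNonneg_holds L Δ f, lowNormPartNonneg_holds L Δ f, ?_, ?_, ?_, ?_, ?_⟩
  · rw [div_le_iff₀ hD, etlo]; exact hTlo
  · rw [le_div_iff₀ hD, ethi]; exact hThi
  · have h1 : ((C.thi : ℤ) : ℝ) ≤ 2 * ((S.eps1.1 : ℤ) : ℝ) := by exact_mod_cast hthi
    rw [div_le_iff₀ hD]
    nlinarith [meps.1]
  · have : (0 : ℝ) ≤ ((C.tlo : ℤ) : ℝ) := by exact_mod_cast htlo0
    positivity
  · rw [sub_zero, sub_zero]
    have ms := mem_iadd (mem_iscale 3 (mem_isqrt (Real.sqrt_nonneg Chi) (by rw [Real.sq_sqrt hChi0]; exact mChi)))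
      (mem_iscale 3 (mem_isqrt (Real.sqrt_nonneg Nhi) (by rw [Real.sq_sqrt hNhi0]; exact mNhi)))
    set s := iadd (iscale 3 (isqrt C.chi)) (iscale 3 (isqrt C.nhi)) with hsdef
    obtain ⟨-, hs2⟩ := ms
    push_cast at hs2
    have hv0 : 0 ≤ 3 * Real.sqrt Chi + 3 * Real.sqrt Nhi := by positivity
    have hvle : 3 * Real.sqrt Chi + 3 * Real.sqrt Nhi ≤ (s.2 : ℝ) / ((D : ℤ) : ℝ) := by
      rw [le_div_iff₀ hD]; exact hs2
    have e2 := (mem_imul (mem_ipt s.2) (mem_ipt s.2)).2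
    have hsq : (3 * Real.sqrt Chi + 3 * Real.sqrt Nhi) ^ 2 * ((D : ℤ) : ℝ) ≤ ((sqSum C : ℤ) : ℝ) := by
      have hle : (3 * Real.sqrt Chi + 3 * Real.sqrt Nhi) ^ 2 ≤ ((s.2 : ℝ) / ((D : ℤ) : ℝ)) * ((s.2 : ℝ) / ((D : ℤ) : ℝ)) := by
        rw [sq]; exact mul_le_mul hvle hvle hv0 (hv0.trans hvle)
      unfold sqSum
      exact (mul_le_mul_of_nonneg_right hle hD.le).trans e2
    have mR := mem_idivn (mem_iscale (bn * (3 * (L * L) ^ 2))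
      (mem_imul (mem_imul (mem_ipt C.eta.1) (mem_isub (mem_iscale 2 (mem_ipt S.eps1.1)) (mem_ipt C.thi))) (mem_ipt C.tlo)))
      (show (0 : ℤ) < (bd : ℤ) by exact_mod_cast hbd)
    obtain ⟨hRlo, -⟩ := mR
    have hineqR : ((sqSum C : ℤ) : ℝ) ≤ ((rhsLo L S C bn bd : ℤ) : ℝ) := by exact_mod_cast hineq
    unfold rhsLo at hineqR
    have hEta : ((C.eta.1 : ℤ) : ℝ) / ((D : ℤ) : ℝ) ≤ (L : ℝ) ^ 2 * lam2 / 4 := by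
      rw [div_le_iff₀ hD]; have := mEta.1; unfold etaEff at this; exact this
    have hEta0 : 0 ≤ ((C.eta.1 : ℤ) : ℝ) / ((D : ℤ) : ℝ) := by
      have : (0 : ℝ) ≤ ((C.eta.1 : ℤ) : ℝ) := by exact_mod_cast heta0
      positivity
    have hEps : ((S.eps1.1 : ℤ) : ℝ) / ((D : ℤ) : ℝ) ≤ eps1 L := by rw [div_le_iff₀ hD]; exact meps.1
    have hThi' : ((C.thi : ℤ) : ℝ) / ((D : ℤ) : ℝ) ≤ 2 * (((S.eps1.1 : ℤ) : ℝ) / ((D : ℤ) : ℝ)) := by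
      rw [div_le_iff₀ hD]
      have h1 : ((C.thi : ℤ) : ℝ) ≤ 2 * ((S.eps1.1 : ℤ) : ℝ) := by exact_mod_cast hthi
      have : 2 * (((S.eps1.1 : ℤ) : ℝ) / ((D : ℤ) : ℝ)) * ((D : ℤ) : ℝ) = 2 * ((S.eps1.1 : ℤ) : ℝ) := by
        field_simp
      linarith
    have hTlo0 : 0 ≤ ((C.tlo : ℤ) : ℝ) / ((D : ℤ) : ℝ) := by
      have : (0 : ℝ) ≤ ((C.tlo : ℤ) : ℝ) := by exact_mod_cast htlo0
      positivity
    have hbn : (0 : ℝ) ≤ bn := by positivity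
    have hbd' : (0 : ℝ) < bd := by exact_mod_cast hbd
    have hmono :
        ((bn * (3 * (L * L) ^ 2) : ℕ) : ℝ) *
            ((((C.eta.1 : ℤ) : ℝ) / ((D : ℤ) : ℝ)) * (((2 : ℕ) : ℝ) * (((S.eps1.1 : ℤ) : ℝ) / ((D : ℤ) : ℝ))
              - ((C.thi : ℤ) : ℝ) / ((D : ℤ) : ℝ)) * (((C.tlo : ℤ) : ℝ) / ((D : ℤ) : ℝ))) / ((bd : ℤ) : ℝ)
          ≤ ((bn : ℝ) / bd) * ((L : ℝ) ^ 2 * lam2 / 4) * (2 * eps1 L - ((C.thi : ℤ) : ℝ) / ((D : ℤ) : ℝ))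
              * (3 * ((L : ℝ) ^ 2) ^ 2 * (((C.tlo : ℤ) : ℝ) / ((D : ℤ) : ℝ))) := by
      have hA : (((C.eta.1 : ℤ) : ℝ) / ((D : ℤ) : ℝ)) * (((2 : ℕ) : ℝ) * (((S.eps1.1 : ℤ) : ℝ) / ((D : ℤ) : ℝ))
              - ((C.thi : ℤ) : ℝ) / ((D : ℤ) : ℝ))
          ≤ ((L : ℝ) ^ 2 * lam2 / 4) * (2 * eps1 L - ((C.thi : ℤ) : ℝ) / ((D : ℤ) : ℝ)) := by
        push_cast
        exact mul_le_mul hEta (by linarith) (by linarith) ((hEta0).trans hEta)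
      have hB := mul_le_mul_of_nonneg_right hA hTlo0
      have hC := mul_le_mul_of_nonneg_left hB (show (0 : ℝ) ≤ ((bn * (3 * (L * L) ^ 2) : ℕ) : ℝ) / ((bd : ℤ) : ℝ) by
        push_cast; positivity)
      have e1 : ((bn * (3 * (L * L) ^ 2) : ℕ) : ℝ) *
            ((((C.eta.1 : ℤ) : ℝ) / ((D : ℤ) : ℝ)) * (((2 : ℕ) : ℝ) * (((S.eps1.1 : ℤ) : ℝ) / ((D : ℤ) : ℝ))
              - ((C.thi : ℤ) : ℝ) / ((D : ℤ) : ℝ)) * (((C.tlo : ℤ) : ℝ) / ((D : ℤ) : ℝ))) / ((bd : ℤ) : ℝ)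
          = ((bn * (3 * (L * L) ^ 2) : ℕ) : ℝ) / ((bd : ℤ) : ℝ) *
            ((((C.eta.1 : ℤ) : ℝ) / ((D : ℤ) : ℝ)) * (((2 : ℕ) : ℝ) * (((S.eps1.1 : ℤ) : ℝ) / ((D : ℤ) : ℝ))
              - ((C.thi : ℤ) : ℝ) / ((D : ℤ) : ℝ)) * (((C.tlo : ℤ) : ℝ) / ((D : ℤ) : ℝ))) := by ring
      have e2 : ((bn * (3 * (L * L) ^ 2) : ℕ) : ℝ) / ((bd : ℤ) : ℝ) *
            (((L : ℝ) ^ 2 * lam2 / 4) * (2 * eps1 L - ((C.thi : ℤ) : ℝ) / ((D : ℤ) : ℝ)) * (((C.tlo : ℤ) : ℝ) / ((D : ℤ) : ℝ)))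
          = ((bn : ℝ) / bd) * ((L : ℝ) ^ 2 * lam2 / 4) * (2 * eps1 L - ((C.thi : ℤ) : ℝ) / ((D : ℤ) : ℝ))
              * (3 * ((L : ℝ) ^ 2) ^ 2 * (((C.tlo : ℤ) : ℝ) / ((D : ℤ) : ℝ))) := by push_cast; ring
      rw [e1]; rw [e2] at hC; exact hC
    have key : (3 * Real.sqrt Chi + 3 * Real.sqrt Nhi) ^ 2 * ((D : ℤ) : ℝ)
        ≤ ((bn : ℝ) / bd) * ((L : ℝ) ^ 2 * lam2 / 4) * (2 * eps1 L - ((C.thi : ℤ) : ℝ) / ((D : ℤ) : ℝ))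
              * (3 * ((L : ℝ) ^ 2) ^ 2 * (((C.tlo : ℤ) : ℝ) / ((D : ℤ) : ℝ))) * ((D : ℤ) : ℝ) := by
      refine hsq.trans (hineqR.trans (hRlo.trans ?_))
      exact mul_le_mul_of_nonneg_right hmono hD.le
    exact le_of_mul_le_mul_right key hD

/-- ★ one row-C X5 cell (cover form): vacuous branches contradictory, certified branch gives the bracket tuple. [folklore] -/
theorem xc_cellAny_soundA (L : ℕ) [NeZero L] (hL : 5 ≤ L) {d1 : ℚ} {bd : ℕ} {Δ lam2 : ℝ} (hΔ0 : 0 < Δ)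
    (hΔd : Δ ≤ (d1 : ℝ)) (hΔ1 : Δ < 1) {f : Tor L → ℝ} (hf : IsGroundTwoMagnon L Δ lam2 f) {la lb : ℤ}
    (hla : (la : ℝ) ≤ lam2 * ((D : ℤ) : ℝ)) (hlb : lam2 * ((D : ℤ) : ℝ) ≤ (lb : ℝ)) {bn : ℕ} {tb : ℤ × ℤ}
    (hTlo : (tb.1 : ℝ) ≤ Tplus L Δ f * ((D : ℤ) : ℝ)) (hThi : Tplus L Δ f * ((D : ℤ) : ℝ) ≤ (tb.2 : ℝ))
    (hok : xcCellAnyA0 L d1 bd la lb bn tb = true) :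
    ∃ Chi Nhi Plo Llo Tlo Thi : ℝ,
      cs2 L f ≤ Chi ∧ nC0p L Δ f ≤ Nhi ∧ Plo ≤ polePart L Δ f ∧ Llo ≤ lowNormPart L Δ f ∧
      Tlo ≤ Tplus L Δ f ∧ Tplus L Δ f ≤ Thi ∧ Thi ≤ 2 * eps1 L ∧ 0 ≤ Tlo ∧
      (3 * Real.sqrt Chi + 3 * Real.sqrt Nhi) ^ 2 - Plo - Llo
        ≤ ((bn : ℝ) / bd) * ((L : ℝ) ^ 2 * lam2 / 4) * (2 * eps1 L - Thi) * (3 * ((L : ℝ) ^ 2) ^ 2 * Tlo) := by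
  have hL3 : 3 ≤ L := by omega
  have hD := D_pos
  have hlam : 0 < lam2 := lam2_pos L hL3 hΔ1 hf.1
  have hΔe : Δ = deltaOfLam L lam2 := ground_delta_eq L hL hΔ0.le hΔ1 hf
  unfold xcCellAnyA0 xcCellAnyTA at hok
  simp only [Bool.or_eq_true, Bool.and_eq_true, decide_eq_true_eq] at hok
  rcases hok with (⟨⟨hpos, hnum⟩, hG0⟩ | ⟨hgc, hvac⟩) | hcert
  · exact (vacuous_of_num_neg (L := L) hL3 hlam hla hlb hpos hnum hG0 hΔ0 hΔ1 hΔe).elim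
  · exfalso
    have hmd := mem_delta_cell L hL3 hlam hla hlb hgc
    rw [← hΔe] at hmd
    obtain ⟨hlo, hhi⟩ := hmd
    rcases hvac with hneg | hbig
    · have : ((((deltaIv L la lb).2 : ℤ)) : ℝ) < 0 := by exact_mod_cast hneg
      nlinarith
    · have hbig' : (d1 : ℝ) * ((D : ℤ) : ℝ) < ((((deltaIv L la lb).1 : ℤ)) : ℝ) := by
        have e : (((D : ℚ)) : ℝ) = ((D : ℤ) : ℝ) := by norm_cast
        rw [← e]; exact_mod_cast hbig
      nlinarith
  · exact xc_cell_soundA hL hΔ0 hΔ1 hf hla hlb hTlo hThi hcert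

end FinXB

namespace FinXD

open scoped BigOperators
open Finset Hole2 FinCell FinXB
/-! ## The GM₃ glue (X5 form) -/

/-- chunking lemma (X5 form). [folklore] -/
theorem cellsAllG5_cons_append (L : ℕ) (d1 : ℚ) (bd : ℕ) {x y : GCell4} {xs ys : List GCell4}
    (h1 : cellsAllG5 L d1 bd (x :: (xs ++ [y])) = true) (h2 : cellsAllG5 L d1 bd (y :: ys) = true) :
    cellsAllG5 L d1 bd (x :: (xs ++ y :: ys)) = true := by
  induction xs generalizing x with
  | nil =>
    simp only [List.nil_append, cellsAllG5, Bool.and_eq_true] at h1 ⊢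
    exact ⟨h1.1, h2⟩
  | cons z zs ih =>
    simp only [List.cons_append, cellsAllG5, Bool.and_eq_true] at h1 ⊢
    exact ⟨h1.1, ih h1.2⟩

/-- the arithmetic cover (X5 form). [folklore] -/
theorem cover_allG5 (L : ℕ) (d1 : ℚ) (bd : ℕ) : ∀ (rest : List GCell4) (a b : GCell4) (x : ℝ),
    cellsAllG5 L d1 bd (a :: b :: rest) = true → (a.lam : ℝ) ≤ x → x ≤ ((cellsLastG4 (a :: b :: rest) : ℤ) : ℝ) →
    ∃ g : GCell4, ∃ nx : ℤ, gmCellOK5 L d1 bd g nx = true ∧ (g.lam : ℝ) ≤ x ∧ x ≤ (nx : ℝ) := by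
  intro rest
  induction rest with
  | nil =>
    intro a b x h hax hxl
    simp only [cellsAllG5, Bool.and_true] at h
    exact ⟨a, b.lam, h, hax, by simpa [cellsLastG4] using hxl⟩
  | cons c rest ih =>
    intro a b x h hax hxl
    rw [show cellsAllG5 L d1 bd (a :: b :: c :: rest) = (gmCellOK5 L d1 bd a b.lam && cellsAllG5 L d1 bd (b :: c :: rest)) from rfl,
      Bool.and_eq_true] at h
    obtain ⟨h1, h2⟩ := h
    by_cases hxb : x ≤ (b.lam : ℝ)
    · exact ⟨a, b.lam, h1, hax, hxb⟩
    · have hbx : (b.lam : ℝ) ≤ x := le_of_lt (lt_of_not_ge hxb)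
      have hl : cellsLastG4 (a :: b :: c :: rest) = cellsLastG4 (b :: c :: rest) := rfl
      rw [hl] at hxl
      exact ih b c x h2 hbx hxl

/-- ★ one GM₃ pair (X5 form): the ground profile with `λ₂·D ∈ [g.lam, nx]` yields `GM3Fibre L Δ` (`9 ≤ L`, `0 < Δ ≤ Δ₁ < 1`). [folklore] -/
theorem gm3_of_gmCellOK5 (L : ℕ) [NeZero L] (hL : 9 ≤ L) {d1 : ℚ} {bd : ℕ} (hbd : 0 < bd) {Δ lam2 : ℝ}
    (hΔ0 : 0 < Δ) (hΔd : Δ ≤ (d1 : ℝ)) (hΔ1 : Δ < 1) {f : Tor L → ℝ} (hf : IsGroundTwoMagnon L Δ lam2 f)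
    {g : GCell4} {nx : ℤ} (hok : gmCellOK5 L d1 bd g nx = true)
    (hlo : (g.lam : ℝ) ≤ lam2 * ((D : ℤ) : ℝ)) (hhi : lam2 * ((D : ℤ) : ℝ) ≤ (nx : ℝ)) : GM3Fibre L Δ := by
  have hL5 : 5 ≤ L := by omega
  unfold gmCellOK5 at hok
  simp only [Bool.and_eq_true] at hok
  obtain ⟨⟨⟨hN, hC⟩, hD'⟩, hS⟩ := hok
  -- row `N₁` with the two exports
  obtain ⟨hN1, hnt, hTlo, hThi⟩ := xbn_cellAny_sound L hL5 hΔ0 hΔd hΔ1 hf hlo hhi hN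
  -- row C reads the `T⁺` brackets; row D and the side condition read `nt`
  have hCC := xc_cellAny_soundA L hL5 hΔ0 hΔd hΔ1 hf hlo hhi hTlo hThi hC
  have hrowD := xdN_cellAny_sound L hL hΔ0 hΔd hΔ1 hf hlo hhi hnt hD'
  obtain ⟨hm, hside⟩ := sdzN_cellAny_sound L hL5 hΔ0 hΔd hΔ1 hf hlo hhi hnt hS
  have huniq : ∀ lam2' : ℝ, ∀ f' : Tor L → ℝ, IsGroundTwoMagnon L Δ lam2' f' → lam2' = lam2 ∧ f' = f := by
    intro lam2' f' hf'
    have hl : lam2' = lam2 := ground_lam2_unique L (by omega) hf' hf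
    subst hl
    exact ⟨rfl, by rw [ground_eq_explicit L hL5 hΔ0.le hΔ1 hf', ground_eq_explicit L hL5 hΔ0.le hΔ1 hf]⟩
  have hKT1 : TrialGapAbs L Δ g.c := by
    intro lam2' f' hf'
    obtain ⟨rfl, rfl⟩ := huniq lam2' f' hf'
    exact hN1
  have hKT2a : LowShellGFormAbs L Δ g.aD := by
    intro lam2' f' hf'
    obtain ⟨rfl, rfl⟩ := huniq lam2' f' hf'
    exact hrowD
  have hbdR : (0 : ℝ) < bd := by exact_mod_cast hbd
  have hKT2b : OffPoleTailAbs L Δ ((g.bn : ℝ) / bd) := by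
    refine KT2Assembly.offPoleTailAbs_of_brackets L (by omega) hΔ1 (by positivity) ?_
    intro lam2' f' hf'
    obtain ⟨rfl, rfl⟩ := huniq lam2' f' hf'
    exact hCC
  have hT2 := Tplus_lt_of_mHole_nonneg L (by omega) hm
  have hside' : facMI L Δ f * etaEff L lam2 * ((g.aD : ℝ) + ((g.bn : ℝ) / bd) / (2 + Real.cos (2 * Real.pi / L))) < (g.c : ℝ) := by
    simpa using hside
  exact gm3_closedRho_twoHoleGap L (by omega) hΔ0 hΔ1 (g.c : ℝ) (g.aD : ℝ) ((g.bn : ℝ) / bd)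
    (Hole2.twoHoleGap_threeQuarter L hL) hf hT2 hm hside' hKT1 hKT2a hKT2b

/-- ★★★ **GM₃ AT THIS `L` FROM THE X4 KERNEL CELL FACTS (X5 form)**: `gmCheck5 L Δ₁ bd cells = true` (`9 ≤ L`) ⟹ `GM3Fibre L Δ`
for every `0 < Δ ≤ Δ₁`, `Δ < 1`. -/
theorem gm3_of_gmCheck5 (L : ℕ) [NeZero L] (hL : 9 ≤ L) {d1 : ℚ} {bd : ℕ} {cells : List GCell4}
    (h : gmCheck5 L d1 bd cells = true) {Δ : ℝ} (hΔ0 : 0 < Δ) (hΔd : Δ ≤ (d1 : ℝ)) (hΔ1 : Δ < 1) : GM3Fibre L Δ := by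
  obtain ⟨lam2, f, hf⟩ := exists_ground L (by omega) Δ
  have hD := D_pos
  unfold gmCheck5 at h
  simp only [Bool.and_eq_true, decide_eq_true_eq] at h
  obtain ⟨⟨⟨⟨hhead, hlen⟩, htop⟩, hbd⟩, hok⟩ := h
  obtain ⟨a, b, rest, hcells⟩ : ∃ a b : GCell4, ∃ rest : List GCell4, cells = a :: b :: rest := by
    match cells, hlen with
    | a :: b :: rest, _ => exact ⟨a, b, rest, rfl⟩
  subst hcells
  have ha0 : a.lam = 0 := by simpa using hhead
  have hwin := forall_ground_of_window_7 L (by omega) hΔ0.le hΔ1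
    (fun lam2' (f' : Tor L → ℝ) => lam2' = lam2 → GM3Fibre L Δ) ?_
  · exact hwin lam2 f hf rfl
  intro lam2' f' hf' hlam0 hlamle hEq
  subst hEq
  set x : ℝ := lam2' * ((D : ℤ) : ℝ) with hx
  have hx0 : (a.lam : ℝ) ≤ x := by rw [ha0, hx]; push_cast; positivity
  have hxtop : x ≤ ((cellsLastG4 (a :: b :: rest) : ℤ) : ℝ) :=
    (lam_mul_D_le_lamTop L (by omega) hlamle).trans (by exact_mod_cast htop)
  obtain ⟨g, nx, hcell, hgx, hxn⟩ := cover_allG5 L d1 bd rest a b x hok hx0 hxtop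
  exact gm3_of_gmCellOK5 L hL hbd hΔ0 hΔd hΔ1 hf' hcell hgx hxn

end FinXD

end Summit.HubbardSuperconductivity.HubbardSuperconductivity.Theorems.AnisotropyChord.Transfer.Fibre3
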